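import Mathlib
import HarnessLib
import HarnessLib.Audit
import Summits.SmoothPoincare4.Statement
import Literature.Topology.FourManifolds.HomotopySpheres
import Literature.Topology.FourManifolds.HomotopyS4CompactProofs
import Literature.Topology.FourManifolds.HomotopyS4OrientableProofs
import HarnessLib.Audit.Status.Attr

/-!
Route: QuotientSpheres

DORMANT since 2026-08-22T17:33:27Z (reconciler: no traction for 5.5 d (last activity item-evidence-added at 2026-08-17T04:19:19Z); parked, not closed — `ledger route dormant route-SmoothPoincare4-QuotientSpheres --off` to reactivate) — unstaffed, not closed; items shared with open routes are served there. `ledger route dormant <id> --off` reactivates.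

# Route QuotientSpheres — Shadows of real symmetries — cyclic branched quotients of the standard S⁴
are standard (QUOT), and every homotopy 4-sphere is such a shadow

It suffices to show X = QUOT₂ ∧ QUOT₍≥₃₎ ∧ SHADOWS (realises card quotient-spheres-orbifold, spine
and only card: its QUOT on the
codimension-2 stratum = cruxes InvolutionQuotient and CyclicQuotient, its structural crux C3 =
CyclicShadows). Call a smooth 4-manifold M
(Hausdorff, second countable) a CYCLIC BRANCHED QUOTIENT OF S⁴ OF ORDER n if there are an order-n
diffeomorphism g of the STANDARD S⁴ with a
fixed point and a smooth map q : S⁴ → M whose fibres are the ⟨g⟩-orbits, which is a local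
diffeomorphism off Fix g and is the standard fold
(z, w) ↦ (z, wⁿ) in charts at the points of Fix g (the predicate is inlined in every item;
HambletonHausmann2010 App. Def. 7.1 / Lemma 7.3:
M is then the orbit space |S⁴/⟨g⟩| with its canonical smooth structure, unique up to diffeomorphism;
the hypotheses force g semifree,
orientation-preserving, Fix g ≅ S² possibly knotted — Giffen1966, Gordon1974, Sumners1975 — and M is
a homotopy 4-sphere, support
QuotientHomotopySphere). InvolutionQuotient (rank 2): every order-2 cyclic branched quotient of S⁴
is diffeomorphic to S⁴ ("folding the real
sphere along a knotted mirror never fakes it"; Montesinos' trick read upward). CyclicQuotient (rank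
4): the same for every order n ≥ 3.
CyclicShadows (rank 3): every homotopy 4-sphere is a cyclic branched quotient of S⁴ of some order n
≥ 2 — equivalently contains a 2-knot one
of whose cyclic branched covers is S⁴ (true in every dimension ≥ 5 by Kervaire–Milnor finiteness;
support FiniteOrder is its dimension-4 shape).
Lean: `(∀ (g : Metric.sphere (0 : EuclideanSpace ℝ (Fin 5)) 1 → Metric.sphere (0 : EuclideanSpace ℝ
(Fin 5)) 1) (M : Type) [TopologicalSpace M] [T2Space M] [SecondCountableTopology M] [ChartedSpace
(EuclideanSpace ℝ (Fin 4)) M] [IsManifold (𝓡 4) ∞ M] (q : Metric.sphere (0 : EuclideanSpace ℝ (Fin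
5)) 1 → M), (∃ x, g x = x) → (ContMDiff (𝓡 4) (𝓡 4) ∞ g ∧ g^[2] = id ∧ ContMDiff (𝓡 4) (𝓡 4) ∞ q ∧
(∀ x, q (g x) = q x) ∧ (∀ x y, q x = q y → ∃ k : ℕ, y = g^[k] x) ∧ Function.Surjective q ∧ (∀ x, g x
≠ x → IsLocalDiffeomorphAt (𝓡 4) (𝓡 4) ∞ q x) ∧ ∀ x, g x = x → ∃ (U : Set (Metric.sphere (0 :
EuclideanSpace ℝ (Fin 5)) 1)) (φ : Metric.sphere (0 : EuclideanSpace ℝ (Fin 5)) 1 → EuclideanSpace ℝ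
(Fin 4)) (V : Set M) (ψ : M → EuclideanSpace ℝ (Fin 4)), IsOpen U ∧ x ∈ U ∧ Set.InjOn φ U ∧ (∀ y ∈
U, IsLocalDiffeomorphAt (𝓡 4) (𝓡 4) ∞ φ y) ∧ IsOpen V ∧ q '' U ⊆ V ∧ Set.InjOn ψ V ∧ (∀ z ∈ V,
IsLocalDiffeomorphAt (𝓡 4) (𝓡 4) ∞ ψ z) ∧ ∀ y ∈ U, ψ (q y) = WithLp.toLp 2 (fun j : Fin 4 => if j =
2 then ((((φ y 2 : ℝ) : ℂ) + ((φ y 3 : ℝ) : ℂ) * Complex.I) ^ 2).re else if j = 3 then ((((φ y 2 :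
ℝ) : ℂ) + ((φ y 3 : ℝ) : ℂ) * Complex.I) ^ 2).im else φ y j)) → Nonempty (M ≃ₘ⟮𝓡 4, 𝓡 4⟯
Metric.sphere (0 : EuclideanSpace ℝ (Fin 5)) 1)) ∧ (∀ (n : ℕ), 3 ≤ n → ∀ (g : Metric.sphere (0 :
EuclideanSpace ℝ (Fin 5)) 1 → Metric.sphere (0 : EuclideanSpace ℝ (Fin 5)) 1) (M : Type)
[TopologicalSpace M] [T2Space M] [SecondCountableTopology M] [ChartedSpace (EuclideanSpace ℝ (Fin
4)) M] [IsManifold (𝓡 4) ∞ M] (q : Metric.sphere (0 : EuclideanSpace ℝ (Fin 5)) 1 → M), (∃ x, g x =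
x) → (ContMDiff (𝓡 4) (𝓡 4) ∞ g ∧ g^[n] = id ∧ ContMDiff (𝓡 4) (𝓡 4) ∞ q ∧ (∀ x, q (g x) = q x) ∧ (∀
x y, q x = q y → ∃ k : ℕ, y = g^[k] x) ∧ Function.Surjective q ∧ (∀ x, g x ≠ x →
IsLocalDiffeomorphAt (𝓡 4) (𝓡 4) ∞ q x) ∧ ∀ x, g x = x → ∃ (U : Set (Metric.sphere (0 :
EuclideanSpace ℝ (Fin 5)) 1)) (φ : Metric.sphere (0 : EuclideanSpace ℝ (Fin 5)) 1 → EuclideanSpace ℝ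
(Fin 4)) (V : Set M) (ψ : M → EuclideanSpace ℝ (Fin 4)), IsOpen U ∧ x ∈ U ∧ Set.InjOn φ U ∧ (∀ y ∈
U, IsLocalDiffeomorphAt (𝓡 4) (𝓡 4) ∞ φ y) ∧ IsOpen V ∧ q '' U ⊆ V ∧ Set.InjOn ψ V ∧ (∀ z ∈ V,
IsLocalDiffeomorphAt (𝓡 4) (𝓡 4) ∞ ψ z) ∧ ∀ y ∈ U, ψ (q y) = WithLp.toLp 2 (fun j : Fin 4 => if j =
2 then ((((φ y 2 : ℝ) : ℂ) + ((φ y 3 : ℝ) : ℂ) * Complex.I) ^ n).re else if j = 3 then ((((φ y 2 :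
ℝ) : ℂ) + ((φ y 3 : ℝ) : ℂ) * Complex.I) ^ n).im else φ y j)) → Nonempty (M ≃ₘ⟮𝓡 4, 𝓡 4⟯
Metric.sphere (0 : EuclideanSpace ℝ (Fin 5)) 1)) ∧ (∀ S :
Literature.Topology.FourManifolds.HomotopySphere 4, ∃ (n : ℕ) (g : Metric.sphere (0 : EuclideanSpace
ℝ (Fin 5)) 1 → Metric.sphere (0 : EuclideanSpace ℝ (Fin 5)) 1) (q : Metric.sphere (0 :
EuclideanSpace ℝ (Fin 5)) 1 → S.carrier), 2 ≤ n ∧ (∃ x, g x = x) ∧ (ContMDiff (𝓡 4) (𝓡 4) ∞ g ∧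
g^[n] = id ∧ ContMDiff (𝓡 4) (𝓡 4) ∞ q ∧ (∀ x, q (g x) = q x) ∧ (∀ x y, q x = q y → ∃ k : ℕ, y =
g^[k] x) ∧ Function.Surjective q ∧ (∀ x, g x ≠ x → IsLocalDiffeomorphAt (𝓡 4) (𝓡 4) ∞ q x) ∧ ∀ x, g
x = x → ∃ (U : Set (Metric.sphere (0 : EuclideanSpace ℝ (Fin 5)) 1)) (φ : Metric.sphere (0 :
EuclideanSpace ℝ (Fin 5)) 1 → EuclideanSpace ℝ (Fin 4)) (V : Set S.carrier) (ψ : S.carrier →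
EuclideanSpace ℝ (Fin 4)), IsOpen U ∧ x ∈ U ∧ Set.InjOn φ U ∧ (∀ y ∈ U, IsLocalDiffeomorphAt (𝓡 4)
(𝓡 4) ∞ φ y) ∧ IsOpen V ∧ q '' U ⊆ V ∧ Set.InjOn ψ V ∧ (∀ z ∈ V, IsLocalDiffeomorphAt (𝓡 4) (𝓡 4) ∞
ψ z) ∧ ∀ y ∈ U, ψ (q y) = WithLp.toLp 2 (fun j : Fin 4 => if j = 2 then ((((φ y 2 : ℝ) : ℂ) + ((φ y
3 : ℝ) : ℂ) * Complex.I) ^ n).re else if j = 3 then ((((φ y 2 : ℝ) : ℂ) + ((φ y 3 : ℝ) : ℂ) *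
Complex.I) ^ n).im else φ y j)))`

## Assembly
Pure logic plus the shared reduction (proved sorry-free in folder/Sketch.lean as `assembly_provable
: Assembly`): given a homotopy 4-sphere S,
CyclicShadows yields n ≥ 2, g, q; if n = 2 InvolutionQuotient gives S.carrier ≅ S⁴, else n ≥ 3 and
CyclicQuotient does; then
Literature.SPC4.smoothPoincare4_of_forall_homotopySphere with
compactSpace_of_homotopyEquiv_sphere_four_holds and
isOrientable_of_homotopyEquiv_sphere_four_holds closes SmoothPoincare4.

Rationale: WHY THIS LINE. Every symmetry line on file puts the group ON the unknown Σ (CircleActionBarrierFour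
as theorem; the cyclic-symmetry cards) or presents Σ as a
quotient by a FREE or antiholomorphic symmetry (ProjectiveRigidityBarrierFour: free involutions of
S⁴ have fake-ℝP⁴ quotients); here the finite
symmetry acts on the STANDARD S⁴, where every tool exists (round metric, linear models, equivariant
tubular neighbourhoods and Kirby calculus,
the finite-subgroups-of-Diff(S⁴) literature ChenKwasikSchultz2015, KwasikSchultz1990), and only the
orbit space is unknown. HambletonHausmann2010
(arXiv:0906.5057) set up exactly this dictionary for involutions — Thm A: smooth conjugations on S⁴
↔ 2-knots in the quotient with its canonical
smooth structure (App. §7), Prop. 5.3: the quotient is HOMEOMORPHIC to S⁴ (Armstrong1968 +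
Freedman1982), Rem. 5.9: DIFFEOMORPHIC for Gordon's
examples (Gluck surgery on twist-spun knots, Gordon1976), as it is by construction for the Pao1978 /
Plotnick1986 cyclic covers of twist-spins — and
stopped there; we file smooth standardness of ALL cyclic branched quotients as SPC4 restricted to
the class 𝒬 of shadows, plus the structural
half 𝒬 = everything, which together assemble to SPC4 by pure logic. Imported areas: transformation
groups (Smith theory, Armstrong, equivariant
tubular neighbourhoods, HH's quotient smoothing), orbifold geometry (Lange2019 = arXiv:1307.4875:
|ℝ⁴/G_x| is a manifold iff G_x is a rotation
group — it delimits the manifold quotients and shows what is NOT yet decomposed: the strata with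
isolated singular points), and high-dimensional
surgery as the guide: for n ≥ 5 Kervaire–Milnor finiteness (KervaireMilnorAnnals1963) makes SHADOWSₙ
a theorem (#ᵐΣ ≅ Sⁿ for m = ord Σ, and
rotating the summands exhibits Σ = Sⁿ/ℤₘ) while QUOTₙ fails exactly at the torsion of Θₙ (Θ₇ = ℤ/28,
Θ₈ = ℤ/2), so any proof of the QUOT cruxes
must use four-dimensional input (equivariant handles / trisections of S⁴, Property R, Fintushel–Pao
on fibred pieces) and their first
corollary is clean and, as far as searched, unclaimed: no 2-torsion — indeed no torsion — in the
monoid of homotopy 4-spheres (support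
NoTwoTorsion). Negatives index empty; no prior route or Theorems file of this summit concerns orbit
spaces of actions on S⁴.

RANKED CRUXES. #2 InvolutionQuotient (crux) — every order-2 cyclic branched quotient of the standard
S⁴ — the orbit space S⁴/τ of a smooth involution τ with a fixed point, in its canonical smooth
structure, exhibited by a smooth fold map q : S⁴ → M with the standard model (z,w) ↦ (z,w²) at Fix τ
— is diffeomorphic to S⁴ (card C1 = QUOT for G = ℤ/2). [difficulty: open-problem] (why it might
fail: a ℤ/2-symmetric Kirby diagram of S⁴ not of branched-cover origin may give a quotient diagram
resisting all moves (= an exotic S⁴); even the unknotted-mirror case contains 'group-ℤ 2-knots are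
smoothly standard' and NoTwoTorsion, both open; the dim-8 analogue is false (Θ₈ = ℤ/2).)
[HambletonHausmann2010, Gordon1974, Giffen1966, Sumners1975, Gordon1976, arXiv:0906.5057]
#3 CyclicShadows (crux) — every homotopy 4-sphere Σ is a cyclic branched quotient of the standard S⁴
of some order n ≥ 2: there are an order-n diffeomorphism g of S⁴ with a fixed point and a smooth
fold map q : S⁴ → Σ with fibres the ⟨g⟩-orbits (card C3, 'size of 𝒬'; equivalently Σ contains a
2-knot one of whose cyclic branched covers is S⁴; implied by FiniteOrder). [difficulty:
open-problem] (why it might fail: an exotic Σ may contain no 2-knot with a cyclic branched cover ≅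
S⁴: unlike n ≥ 5 (Θₙ finite ⇒ #ᵐΣ ≅ Sⁿ ⇒ Σ = Sⁿ/ℤₘ) nothing known forces finite order in the monoid
of homotopy 4-spheres, and no invariant certifying 'not a shadow' exists either.)
[KervaireMilnorAnnals1963, HambletonHausmann2010, Plotnick1986, Pao1978]
#4 CyclicQuotient (crux) — for every n ≥ 3, every order-n cyclic branched quotient of the standard
S⁴ (orbit space of a semifree ℤ/n-action by diffeomorphisms with fixed 2-sphere, canonical smooth
structure, fold model (z,w) ↦ (z,wⁿ)) is diffeomorphic to S⁴ (card C2 restricted to the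
codimension-2 stratum; the strata with isolated singular points wait for definition D1). [deps:
InvolutionQuotient] [difficulty: open-problem] (why it might fail: Pao/Plotnick: S⁴ is the p-fold
cyclic branched cover of S⁴ over twist-spun knots for infinitely many (p,k), so order-n deck groups
with knotted fixed spheres abound; a ℤ/n-symmetric presentation of S⁴ of other origin could have an
exotic quotient; false in dim 7 (Θ₇ = ℤ/28).) [Pao1978, Plotnick1986, Gordon1976, Sumners1975,
HambletonHausmann2010]
#9 QuotientHomotopySphere (support) — every cyclic branched quotient M of S⁴ (any order n ≥ 2) is
compact and simply connected with H₂(M;ℤ) = 0 — Armstrong1968 (π₁ of the orbit space is G modulo the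
isotropy-generated subgroup, = 1 since g fixes a point), transfer (H*(M;ℚ) = H*(S⁴;ℚ)^G with g
orientation-preserving by the fold model), H₂ torsion-free; with spc4.S10
(Literature.Topology.FourManifolds.nonempty_homotopyEquiv_sphere_four_iff) M ≃ S⁴, so SPC4 ⇒ each
crux: the route is an honest weakening plus a bridge (cf. HambletonHausmann2010 Prop. 5.3).
[difficulty: L] [Armstrong1968, HambletonHausmann2010]
#9 LinearQuotientModel (support) — non-vacuity / definition-leak test of the inlined predicate: for
the linear rotation g of order n ≥ 2 in the last two coordinates of ℝ⁵ there is a smooth fold map q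
: S⁴ → S⁴ exhibiting the standard S⁴ as its own order-n cyclic branched quotient (explicitly q(x′,w)
= (x′,wⁿ)/‖(x′,wⁿ)‖ with the chart correction w ↦ w·‖·‖^(-1/n) at the fixed sphere;
HambletonHausmann2010 Ex. 7.4 style). A refuter who cannot build q has found a leak in the
predicate. [difficulty: M] [HambletonHausmann2010]
#9 NoTwoTorsion (support) — no 2-torsion among homotopy 4-spheres: if Σ # Σ (same orientation twice)
is diffeomorphic to S⁴ then Σ ≅ S⁴. Corollary of InvolutionQuotient (the swap involution of Σ # Σ =
double cover of Σ branched along an unknotted 2-sphere is a smooth involution of S⁴ with quotient Σ;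
the deck swap preserves orientation, so it is Σ # Σ not Σ # Σ̄ — refuter-triage sharpening (ii))
and, independently, of the smooth Schoenflies conjecture (Σ° ⊂ S⁴ would be a Schoenflies ball); the
cheapest statement on which the line is tested — an order-2 exotic sphere refutes
InvolutionQuotient. [difficulty: open-problem] [KervaireMilnorAnnals1963, HambletonHausmann2010]
#9 FiniteOrder (support) — every homotopy 4-sphere has finite order in the connected-sum monoid: Σ ≅
S⁴, or #ᵐ⁺²Σ ≅ S⁴ for some m (a chain T₀ = Σ#Σ, Tᵢ₊₁ = Tᵢ#Σ ending at S⁴). The dimension-4 shape of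
Kervaire–Milnor finiteness; SUFFICIENT for CyclicShadows (glue, layer 2: the ℤ/(m+2)-rotation of the
summands of #ᵐ⁺²Σ ≅ S⁴ is a semifree action on S⁴ with unknotted-in-Σ branch sphere and quotient Σ);
implied by SPC4; with InvolutionQuotient ∧ CyclicQuotient it gives 'no torsion' outright.
[difficulty: open-problem] [KervaireMilnorAnnals1963, HambletonHausmann2010]

TWO-LAYER PLAN. Foreseen glued splits (none filed now; k ≤ 3, depth 1): CyclicShadows ⇐ FiniteOrder
→ RotateSummands (FiniteOrder → CyclicShadows, the
ℤ/m-rotation of #ᵐΣ) → CyclicShadows; InvolutionQuotient ⇐ UnknottedMirror (Fix τ unknotted ⇔ branch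
knot of group ℤ: 'group-ℤ 2-knots in
shadows are smoothly unknotted' + NoTwoTorsion) → KnottedMirror (τ not conformal for any round
structure) → InvolutionQuotient;
InvolutionQuotient ⇐ LowGenusInvariant (involutions with an invariant genus-≤-5 trisection / small
bridge trisection of the fixed knot: the
quotient trisection has genus ≤ 2, LowGenusTrisectionBarrier as ENGINE) → ReductionToLowGenus →
InvolutionQuotient; CyclicQuotient ⇐ FibredMirror
(fixed knot fibred, Pao–Plotnick circle-action engine) → general.

KILL CRITERIA. InvolutionQuotient or CyclicQuotient refuted — an explicit cyclic branched quotient M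
of S⁴ proved not diffeomorphic to S⁴ — is ¬SPC4 outright,
with an unusually strong certificate (an n-fold cyclic branched cover of M over an explicit 2-knot
IS S⁴, so every cover-functorial invariant
was doomed): close `refuted:InvolutionQuotient` (resp. CyclicQuotient) and hand M to the negative
routes (ZeroSurgeryExotic, GluckLasagna).
NoTwoTorsion refuted (an order-2 exotic sphere) refutes InvolutionQuotient as well. CyclicShadows
refuted (some Σ provably not a shadow — this
needs a new 'not-a-quotient' invariant and is informative in itself) caps the line at SPC4|𝒬: pivot
by `--restate` of the Assembly into a
conditional bridge on CyclicShadows or re-rank as a classification route for finite cyclic subgroups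
of Diff(S⁴) with 2-dimensional fixed set.
FiniteOrder refuted does not break the route (it is only sufficient for CyclicShadows). SPC4 proved
on any route moots everything; the smooth
Schoenflies conjecture (route SchoenfliesSplit) proved yields NoTwoTorsion but none of the cruxes.

NOT DECOMPOSED YET. (i) The strata of Lange's rotation groups with isolated singular points (cyclic
ℤ/pq acting on two planes, dihedral and polyhedral isotropy;
|S³/G_x| ≅ S³ coned off by B⁴, well defined by Γ₄ = 0) — the card's full C2 — wait for definition D1
and are layer-2 children of
CyclicQuotient. (ii) The engines are deliberately not items: E1 invariant handle decompositions /
bridge trisections of (S⁴, Fix) descend with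
complexity cut by |G| (genus ≤ 2 or 'no 1-handles, one 2-handle' downstairs ⇒ S⁴); E2 fibred fixed
knots (twist-spins: Zeeman, Pao1978,
Plotnick1986) give circle actions on the pieces; E3 conformal ⇒ linear (a compact subgroup of
SO(5,1) fixes a point of ℍ⁵), which relocates
the problem to non-conformalisable = knotted mirrors. (iii) The supply census (involutions of S⁴
read off ℤ/2-symmetric Cappell–Shaneson /
Akbulut–Kirby / Gompf diagrams, quotient diagrams decided by Kirby calculus; kit + SnapPy/Regina for
the 3-dimensional pieces) is a refuter /
compute programme, not an item. (iv) The glue FiniteOrder → CyclicShadows and the corollary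
InvolutionQuotient → NoTwoTorsion are provable
constructions (equivariant connected sum) left to provers with `--supports`.

CHEAPEST FALSIFIER. Literature first: a theorem deciding the DIFFEOMORPHISM type of S⁴/τ for every
smooth involution τ of S⁴ with 2-dimensional fixed set would make
InvolutionQuotient `known` (searched 2026-08-15: HambletonHausmann2010 Prop. 5.3 stops at
homeomorphism, Rem. 5.9 covers only Gordon's
examples; Plotnick1986 and ChenKwasikSchultz2015 classify groups / fixed data, not quotients —
paywalled copies requested acq-01621, acq-02467),
or an involution in the transformation-groups literature whose quotient is recorded as undecided
(none found). Mathematically: the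
definition-leak test LinearQuotientModel (if the inlined predicate cannot be instantiated by the
linear rotation, every crux is vacuous and
CyclicShadows false); then the first census entry — the ℤ/2-symmetry A ↦ A⁻¹ of Gompf's handle
picture of the Akbulut–Kirby sphere (now known
to be S⁴) gives an involution of S⁴ not visibly of branched-cover origin: decide its quotient
diagram by Kirby calculus.

NUMBERS. Dimension ladder for QUOTₙ ('cyclic branched quotients of Sⁿ are standard') / SHADOWSₙ: n =
3: QUOT₃ = Poincaré (Perelman), Smith₃ true
(Morgan–Bass 1984); n = 4: Smith₄ FALSE — infinitely many knotted fixed 2-spheres of smooth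
involutions / ℤ_p-actions on S⁴ (Giffen1966,
Gordon1974, Sumners1975; Pao1978: the p-fold cyclic branched covers of k-twist-spins are S⁴), QUOT₄
open = this route, all known examples have
quotient S⁴ (HambletonHausmann2010 Rem. 5.9); n = 5, 6: Θ₅ = Θ₆ = 0 so QUOTₙ and SHADOWSₙ true; n =
7: Θ₇ = ℤ/28, n = 8: Θ₈ = ℤ/2 — SHADOWSₙ true
(finiteness) and QUOTₙ false (torsion) (KervaireMilnorAnnals1963). Lange2019: |ℝⁿ/Γ| is a
topological manifold iff Γ is generated by
rotations and Poincaré-icosahedral suspension factors; for n = 4 smooth/PL charts: rotation groups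
only. Items at open: 8 (3 cruxes, 4 support,
1 assembly).

DEFINITION REQUESTS. D1 (to be filed after open, `--kind definition --notion RotationalQuotientFour
--topic Literature/Topology/FourManifolds`): the underlying smooth
4-manifold |S⁴/G| of a smooth effective action of a finite group G on S⁴ all of whose isotropy
groups are rotation groups (Lange2019), i.e.
HambletonHausmann2010 Lemma 7.3 along the codimension-2 strata plus the cone-off smoothing at
isolated singular points — needed to state the
card's C2 beyond the semifree cyclic stratum. Cite facts wanted (as hypotheses for
QuotientHomotopySphere): Armstrong1968 (π₁ of an orbit space =
G/⟨elements with fixed points⟩); HambletonHausmann2010 Lemma 7.3 (existence and uniqueness of the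
quotient smooth structure); Lange2019 main
theorem. Literature acquisition requests open: acq-01621 (Plotnick1986), acq-02467
(ChenKwasikSchultz2015 journal version; arXiv:1412.5901 read).

Novelty: Searches (2026-08-15; local searchd index unavailable rc 75 three times, OpenAlex/S2/arXiv APIs
rate-limited, so zbMATH/Crossref/vsearch/galaxy
were used): `lit search --source zbmath "higher-dimensional Smith conjecture"` (15; → Gordon1974
doi:10.1112/plms/s3-29.1.98, HambletonHausmann2010
doi:10.1007/s00209-010-0748-8); `lit search --source crossref "Giffen generalized Smith conjecture"`
(6; Giffen1966 doi:10.2307/2373054,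
Vinogradov–Kushel'man 1972 doi:10.1007/bf00967636, Lü 2000); `… "Sumners smooth Z_p actions knots
pointwise fixed"` (Sumners1975
doi:10.1090/s0002-9947-1975-0372893-8); `lit search --source zbmath "underlying space orbifold
manifold Lange"` (2; Lange2019 = arXiv:1307.4875 —
the card's 1509.06216 was a wrong id); `… crossref "finite symmetries of S^4"`
(ChenKwasikSchultz2015; arXiv:1412.5901 READ: which finite groups
act, G ⊂ SO(5); nothing on orbit spaces); `… crossref Plotnick 1986`
(doi:10.1090/s0002-9947-1986-0846597-6; paywalled, acq-01621);
`lit vsearch "smooth involution on the 4-sphere fixed knotted 2-sphere orbit space"` (12 docs;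
GordonKirby1984 pp. 46 and 403 READ: Pao's covers of
twist-spins are S⁴; Fukuhara/Aitchison–Rubinstein on fixed circles); `lit galaxy search "generalized
Smith conjecture" --star all` (9 panama books;
Morgan–Bass, The Smith Conjecture, Ch. II §2 READ); `lit frontier SmoothPoincare4 --since 2020` (30
rows: arXiv:2605.26337 'Branched coverings of
simply connected 4-manifolds' and arXiv:2603.22202 are the downward direction  [refs: 10.1112/plms/s3-29.1.98, 10.1007/s00209-010-0748-8, 10.2307/2373054, 10.1007/bf00967636, 10.1090/s0002-9947-1975-0372893-8, 10.1090/s0002-9947-1986-0846597-6, 1307.4875, 1412.5901, 2605.26337, 2603.22202, 0906.5057, doi:10.1112/plms/s3-29.1.98, doi:10.1007/s00209-010-0748-8, doi:10.2307/2373054, doi:10.1007/bf00967636, doi:10.1090/s0002-9947-1975-0372893-8, doi:10.1090/s0002-9947-1986-0846597-6, a]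

Barriers (technique_class: finite-group-actions-on-S4; orbifold-quotients): - technique_class: finite-group-actions-on-S4; orbifold-quotients
- Literature.Barriers.SmoothPoincare4.ProjectiveRigidityBarrierFour: respected by construction — the
fixed-point hypothesis (∃ x, g x = x) excludes free involutions, whose quotients are homotopy ℝP⁴'s
(Cappell–Shaneson / Fintushel–Stern exotic); nothing here descends from a rigidity of ℝP⁴, the
recognisers are 4-dimensional and constructive on the quotient of a NON-free action
- Literature.Barriers.SmoothPoincare4.CircleActionBarrierFour: not met — finite groups only, and no
exotic sphere with S¹-symmetry is ever proposed; used later only as an ENGINE (fibred fixed knots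
give circle actions on pieces recognised by Fintushel–Pao / Orlik–Raymond, as in
HambletonHausmann2010 Ex. 7.9)
- Literature.Barriers.SmoothPoincare4.TwistedSphereBarrierFour: used positively (Γ₄ = 0 makes Σ° ∪
B⁴, the cone-offs of D1 and the branched-cover gluings well defined); no twisted-sphere candidate is
proposed
- Literature.Barriers.SmoothPoincare4.LowGenusTrisectionBarrier: used as an ENGINE, not violated —
an invariant trisection of (S⁴, Fix g) descends to a trisection of the quotient of smaller genus,
and genus ≤ 2 forces S⁴
- Literature.Barriers.SmoothPoincare4.CappellShanesonFamilyBarrier: the Cappell–Shaneson spheres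
known to be standard are legitimate UPSTAIRS objects whose ℤ/2-symmetries feed the supply census;
none is proposed as a counterexample
- Literature.Barriers.SmoothPoincare4.GluckTwistCP2Barrier: not engaged — no ℂP²-s

History (route lifecycle, newest last):
- 2026-08-22T17:33:27Z · DORMANT — reconciler: no traction for 5.5 d (last activity item-evidence-added at 2026-08-17T04:19:19Z); parked, not closed — `ledger route dormant route-SmoothPoincare4- (operator:999:1526630)

sub-problem: SmoothPoincare4 · status: dormant · opened planner-plancard-SmoothPoincare4-SmoothPoinca-2e84d903-0 2026-08-15T12:32:44Z · rev 1 · ledger route-SmoothPoincare4-QuotientSpheres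
GENERATED by the gate from the ledger (D-0016/17). Provers cite these decls: `theorem foo : Summit.SmoothPoincare4.SmoothPoincare4.Theses.QuotientSpheres.<Decl> := …` in Summits/SmoothPoincare4/SmoothPoincare4/Theorems/<Name>.lean.
-/

namespace Summit.SmoothPoincare4.SmoothPoincare4.Theses.QuotientSpheres

open scoped BigOperators Topology Manifold Classical MeasureTheory ProbabilityTheory Matrix InnerProductSpace ComplexConjugate ContinuousMap ContDiff
open Filter Set Function TopologicalSpace MeasureTheory

attribute [summit_statement] _root_.SmoothPoincare4

open Literature.SPC4

/-- item stmt-SmoothPoincare4-8188 · crux · rank 2 · open · by planner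
why it might fail: a ℤ/2-symmetric Kirby diagram of S⁴ not of branched-cover origin may give a quotient diagram resisting all moves (= an exotic S⁴); even the unknotted-mirror case contains 'group-ℤ 2-knots are smoothly standard' and NoTwoTorsion, both open; the dim-8 analogue is false (Θ₈ = ℤ/2).
sources: HambletonHausmann2010, Gordon1974, Giffen1966, Sumners1975, Gordon1976, arXiv:0906.5057
[crux] every order-2 cyclic branched quotient of the standard S⁴ — the orbit space S⁴/τ of a smooth
involution τ with a fixed point, in its canonical smooth structure, exhibited by a smooth fold map q
: S⁴ → M with the standard model (z,w) ↦ (z,w²) at Fix τ — is diffeomorphic to S⁴ (card C1 = QUOT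
for G = ℤ/2). [difficulty: open-problem] -/
@[route_item "route-SmoothPoincare4-QuotientSpheres", crux]
def InvolutionQuotient : Prop :=
  ∀ (g : Metric.sphere (0 : EuclideanSpace ℝ (Fin 5)) 1 → Metric.sphere (0 : EuclideanSpace ℝ (Fin 5)) 1) (M : Type) [TopologicalSpace M] [T2Space M] [SecondCountableTopology M] [ChartedSpace (EuclideanSpace ℝ (Fin 4)) M] [IsManifold (𝓡 4) ∞ M] (q : Metric.sphere (0 : EuclideanSpace ℝ (Fin 5)) 1 → M), (∃ x, g x = x) → (ContMDiff (𝓡 4) (𝓡 4) ∞ g ∧ g^[2] = id ∧ ContMDiff (𝓡 4) (𝓡 4) ∞ q ∧ (∀ x, q (g x) = q x) ∧ (∀ x y, q x = q y → ∃ k : ℕ, y = g^[k] x) ∧ Function.Surjective q ∧ (∀ x, g x ≠ x → IsLocalDiffeomorphAt (𝓡 4) (𝓡 4) ∞ q x) ∧ ∀ x, g x = x → ∃ (U : Set (Metric.sphere (0 : EuclideanSpace ℝ (Fin 5)) 1)) (φ : Metric.sphere (0 : EuclideanSpace ℝ (Fin 5)) 1 → EuclideanSpace ℝ (Fin 4))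 (V : Set M) (ψ : M → EuclideanSpace ℝ (Fin 4)), IsOpen U ∧ x ∈ U ∧ Set.InjOn φ U ∧ (∀ y ∈ U, IsLocalDiffeomorphAt (𝓡 4) (𝓡 4) ∞ φ y) ∧ IsOpen V ∧ q '' U ⊆ V ∧ Set.InjOn ψ V ∧ (∀ z ∈ V, IsLocalDiffeomorphAt (𝓡 4) (𝓡 4) ∞ ψ z) ∧ ∀ y ∈ U, ψ (q y) = WithLp.toLp 2 (fun j : Fin 4 => if j = 2 then ((((φ y 2 : ℝ) : ℂ) + ((φ y 3 : ℝ) : ℂ) * Complex.I) ^ 2).re else if j = 3 then ((((φ y 2 : ℝ) : ℂ) + ((φ y 3 : ℝ) : ℂ) * Complex.I) ^ 2).im else φ y j)) → Nonempty (M ≃ₘ⟮𝓡 4, 𝓡 4⟯ Metric.sphere (0 : EuclideanSpace ℝ (Fin 5)) 1)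

/-- item stmt-SmoothPoincare4-8189 · crux · rank 3 · open · by planner
why it might fail: an exotic Σ may contain no 2-knot with a cyclic branched cover ≅ S⁴: unlike n ≥ 5 (Θₙ finite ⇒ #ᵐΣ ≅ Sⁿ ⇒ Σ = Sⁿ/ℤₘ) nothing known forces finite order in the monoid of homotopy 4-spheres, and no invariant certifying 'not a shadow' exists either.
sources: KervaireMilnorAnnals1963, HambletonHausmann2010, Plotnick1986, Pao1978
[crux] every homotopy 4-sphere Σ is a cyclic branched quotient of the standard S⁴ of some order n ≥
2: there are an order-n diffeomorphism g of S⁴ with a fixed point and a smooth fold map q : S⁴ → Σ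
with fibres the ⟨g⟩-orbits (card C3, 'size of 𝒬'; equivalently Σ contains a 2-knot one of whose
cyclic branched covers is S⁴; implied by FiniteOrder). [difficulty: open-problem] -/
@[route_item "route-SmoothPoincare4-QuotientSpheres", crux]
def CyclicShadows : Prop :=
  ∀ S : Literature.Topology.FourManifolds.HomotopySphere 4, ∃ (n : ℕ) (g : Metric.sphere (0 : EuclideanSpace ℝ (Fin 5)) 1 → Metric.sphere (0 : EuclideanSpace ℝ (Fin 5)) 1) (q : Metric.sphere (0 : EuclideanSpace ℝ (Fin 5)) 1 → S.carrier), 2 ≤ n ∧ (∃ x, g x = x) ∧ (ContMDiff (𝓡 4) (𝓡 4) ∞ g ∧ g^[n] = id ∧ ContMDiff (𝓡 4) (𝓡 4) ∞ q ∧ (∀ x, q (g x) = q x) ∧ (∀ x y, q x = q y → ∃ k : ℕ, y = g^[k] x) ∧ Function.Surjective q ∧ (∀ x, g x ≠ x → IsLocalDiffeomorphAt (𝓡 4) (𝓡 4) ∞ q x) ∧ ∀ x, g x = x → ∃ (U : Set (Metric.sphere (0 : EuclideanSpace ℝ (Fin 5)) 1)) (φ : Metric.sphere (0 : EuclideanSpace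 ℝ (Fin 5)) 1 → EuclideanSpace ℝ (Fin 4)) (V : Set S.carrier) (ψ : S.carrier → EuclideanSpace ℝ (Fin 4)), IsOpen U ∧ x ∈ U ∧ Set.InjOn φ U ∧ (∀ y ∈ U, IsLocalDiffeomorphAt (𝓡 4) (𝓡 4) ∞ φ y) ∧ IsOpen V ∧ q '' U ⊆ V ∧ Set.InjOn ψ V ∧ (∀ z ∈ V, IsLocalDiffeomorphAt (𝓡 4) (𝓡 4) ∞ ψ z) ∧ ∀ y ∈ U, ψ (q y) = WithLp.toLp 2 (fun j : Fin 4 => if j = 2 then ((((φ y 2 : ℝ) : ℂ) + ((φ y 3 : ℝ) : ℂ) * Complex.I) ^ n).re else if j = 3 then ((((φ y 2 : ℝ) : ℂ) + ((φ y 3 : ℝ) : ℂ) * Complex.I) ^ n).im else φ y j))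

/-- item stmt-SmoothPoincare4-8190 · crux · rank 4 · open · by planner
why it might fail: Pao/Plotnick: S⁴ is the p-fold cyclic branched cover of S⁴ over twist-spun knots for infinitely many (p,k), so order-n deck groups with knotted fixed spheres abound; a ℤ/n-symmetric presentation of S⁴ of other origin could have an exotic quotient; false in dim 7 (Θ₇ = ℤ/28).
sources: Pao1978, Plotnick1986, Gordon1976, Sumners1975, HambletonHausmann2010
[crux] for every n ≥ 3, every order-n cyclic branched quotient of the standard S⁴ (orbit space of a
semifree ℤ/n-action by diffeomorphisms with fixed 2-sphere, canonical smooth structure, fold model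
(z,w) ↦ (z,wⁿ)) is diffeomorphic to S⁴ (card C2 restricted to the codimension-2 stratum; the strata
with isolated singular points wait for definition D1). [deps: InvolutionQuotient] [difficulty:
open-problem] -/
@[route_item "route-SmoothPoincare4-QuotientSpheres", crux]
def CyclicQuotient : Prop :=
  ∀ (n : ℕ), 3 ≤ n → ∀ (g : Metric.sphere (0 : EuclideanSpace ℝ (Fin 5)) 1 → Metric.sphere (0 : EuclideanSpace ℝ (Fin 5)) 1) (M : Type) [TopologicalSpace M] [T2Space M] [SecondCountableTopology M] [ChartedSpace (EuclideanSpace ℝ (Fin 4)) M] [IsManifold (𝓡 4) ∞ M] (q : Metric.sphere (0 : EuclideanSpace ℝ (Fin 5)) 1 → M), (∃ x, g x = x) → (ContMDiff (𝓡 4) (𝓡 4) ∞ g ∧ g^[n] = id ∧ ContMDiff (𝓡 4) (𝓡 4) ∞ q ∧ (∀ x, q (g x) = q x) ∧ (∀ x y, q x = q y → ∃ k : ℕ, y = g^[k] x) ∧ Function.Surjective q ∧ (∀ x, g x ≠ x → IsLocalDiffeomorphAt (𝓡 4) (𝓡 4) ∞ q x) ∧ ∀ x, g x = x → ∃ (U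 : Set (Metric.sphere (0 : EuclideanSpace ℝ (Fin 5)) 1)) (φ : Metric.sphere (0 : EuclideanSpace ℝ (Fin 5)) 1 → EuclideanSpace ℝ (Fin 4)) (V : Set M) (ψ : M → EuclideanSpace ℝ (Fin 4)), IsOpen U ∧ x ∈ U ∧ Set.InjOn φ U ∧ (∀ y ∈ U, IsLocalDiffeomorphAt (𝓡 4) (𝓡 4) ∞ φ y) ∧ IsOpen V ∧ q '' U ⊆ V ∧ Set.InjOn ψ V ∧ (∀ z ∈ V, IsLocalDiffeomorphAt (𝓡 4) (𝓡 4) ∞ ψ z) ∧ ∀ y ∈ U, ψ (q y) = WithLp.toLp 2 (fun j : Fin 4 => if j = 2 then ((((φ y 2 : ℝ) : ℂ) + ((φ y 3 : ℝ) : ℂ) * Complex.I) ^ n).re else if j = 3 then ((((φ y 2 : ℝ) : ℂ) + ((φ y 3 : ℝ) : ℂ) * Complex.I) ^ n).im else φ y j)) → Nonempty (M ≃ₘ⟮𝓡 4, 𝓡 4⟯ Metric.sphere (0 : EuclideanSpace ℝ (Fin 5)) 1)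

/-- item stmt-SmoothPoincare4-8191 · support · rank 9 · open · by planner
sources: Armstrong1968, HambletonHausmann2010
[support] every cyclic branched quotient M of S⁴ (any order n ≥ 2) is compact and simply connected
with H₂(M;ℤ) = 0 — Armstrong1968 (π₁ of the orbit space is G modulo the isotropy-generated subgroup,
= 1 since g fixes a point), transfer (H*(M;ℚ) = H*(S⁴;ℚ)^G with g orientation-preserving by the fold
model), H₂ torsion-free; with spc4.S10
(Literature.Topology.FourManifolds.nonempty_homotopyEquiv_sphere_four_iff) M ≃ S⁴, so SPC4 ⇒ each
crux: the route is an honest weakening plus a bridge (cf. HambletonHausmann2010 Prop. 5.3).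
[difficulty: L] -/
@[route_item "route-SmoothPoincare4-QuotientSpheres"]
def QuotientHomotopySphere : Prop :=
  ∀ (n : ℕ), 2 ≤ n → ∀ (g : Metric.sphere (0 : EuclideanSpace ℝ (Fin 5)) 1 → Metric.sphere (0 : EuclideanSpace ℝ (Fin 5)) 1) (M : Type) [TopologicalSpace M] [T2Space M] [SecondCountableTopology M] [ChartedSpace (EuclideanSpace ℝ (Fin 4)) M] [IsManifold (𝓡 4) ∞ M] (q : Metric.sphere (0 : EuclideanSpace ℝ (Fin 5)) 1 → M), (∃ x, g x = x) → (ContMDiff (𝓡 4) (𝓡 4) ∞ g ∧ g^[n] = id ∧ ContMDiff (𝓡 4) (𝓡 4) ∞ q ∧ (∀ x, q (g x) = q x) ∧ (∀ x y, q x = q y → ∃ k : ℕ, y = g^[k] x) ∧ Function.Surjective q ∧ (∀ x, g x ≠ x → IsLocalDiffeomorphAt (𝓡 4) (𝓡 4) ∞ q x) ∧ ∀ x, g x = x → ∃ (U : Set (Metric.sphere (0 : EuclideanSpace ℝ (Fin 5)) 1)) (φ : Metric.sphere (0 : EuclideanSpace ℝ (Fin 5)) 1 → EuclideanSpace ℝ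 (Fin 4)) (V : Set M) (ψ : M → EuclideanSpace ℝ (Fin 4)), IsOpen U ∧ x ∈ U ∧ Set.InjOn φ U ∧ (∀ y ∈ U, IsLocalDiffeomorphAt (𝓡 4) (𝓡 4) ∞ φ y) ∧ IsOpen V ∧ q '' U ⊆ V ∧ Set.InjOn ψ V ∧ (∀ z ∈ V, IsLocalDiffeomorphAt (𝓡 4) (𝓡 4) ∞ ψ z) ∧ ∀ y ∈ U, ψ (q y) = WithLp.toLp 2 (fun j : Fin 4 => if j = 2 then ((((φ y 2 : ℝ) : ℂ) + ((φ y 3 : ℝ) : ℂ) * Complex.I) ^ n).re else if j = 3 then ((((φ y 2 : ℝ) : ℂ) + ((φ y 3 : ℝ) : ℂ) * Complex.I) ^ n).im else φ y j)) → CompactSpace M ∧ SimplyConnectedSpace M ∧ CategoryTheory.Limits.IsZero (Literature.Topology.FourManifolds.singularHomologyZ M 2)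

/-- item stmt-SmoothPoincare4-8192 · support · rank 9 · open · by planner
sources: HambletonHausmann2010
[support] non-vacuity / definition-leak test of the inlined predicate: for the linear rotation g of
order n ≥ 2 in the last two coordinates of ℝ⁵ there is a smooth fold map q : S⁴ → S⁴ exhibiting the
standard S⁴ as its own order-n cyclic branched quotient (explicitly q(x′,w) = (x′,wⁿ)/‖(x′,wⁿ)‖ with
the chart correction w ↦ w·‖·‖^(-1/n) at the fixed sphere; HambletonHausmann2010 Ex. 7.4 style). A
refuter who cannot build q has found a leak in the predicate. [difficulty: M] -/
@[route_item "route-SmoothPoincare4-QuotientSpheres"]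
def LinearQuotientModel : Prop :=
  ∀ (n : ℕ), 2 ≤ n → ∀ (g : Metric.sphere (0 : EuclideanSpace ℝ (Fin 5)) 1 → Metric.sphere (0 : EuclideanSpace ℝ (Fin 5)) 1), (∀ x : Metric.sphere (0 : EuclideanSpace ℝ (Fin 5)) 1, ((g x : EuclideanSpace ℝ (Fin 5)) = WithLp.toLp 2 (fun i : Fin 5 => if i = 3 then Real.cos (2 * Real.pi / n) * (x : EuclideanSpace ℝ (Fin 5)) 3 - Real.sin (2 * Real.pi / n) * (x : EuclideanSpace ℝ (Fin 5)) 4 else if i = 4 then Real.sin (2 * Real.pi / n) * (x : EuclideanSpace ℝ (Fin 5)) 3 + Real.cos (2 * Real.pi / n) * (x : EuclideanSpace ℝ (Fin 5)) 4 else (x : EuclideanSpace ℝ (Fin 5)) i))) → ∃ q : Metric.sphere (0 : EuclideanSpace ℝ (Fin 5)) 1 → Metric.sphere (0 : EuclideanSpace ℝ (Fin 5)) 1, (ContMDiff (𝓡 4) (𝓡 4) ∞ g ∧ g^[n] = id ∧ ContMDiff (𝓡 4) (𝓡 4) ∞ q ∧ (∀ x, q (g x) = q x) ∧ (∀ x y,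 q x = q y → ∃ k : ℕ, y = g^[k] x) ∧ Function.Surjective q ∧ (∀ x, g x ≠ x → IsLocalDiffeomorphAt (𝓡 4) (𝓡 4) ∞ q x) ∧ ∀ x, g x = x → ∃ (U : Set (Metric.sphere (0 : EuclideanSpace ℝ (Fin 5)) 1)) (φ : Metric.sphere (0 : EuclideanSpace ℝ (Fin 5)) 1 → EuclideanSpace ℝ (Fin 4)) (V : Set (Metric.sphere (0 : EuclideanSpace ℝ (Fin 5)) 1)) (ψ : Metric.sphere (0 : EuclideanSpace ℝ (Fin 5)) 1 → EuclideanSpace ℝ (Fin 4)), IsOpen U ∧ x ∈ U ∧ Set.InjOn φ U ∧ (∀ y ∈ U, IsLocalDiffeomorphAt (𝓡 4) (𝓡 4) ∞ φ y) ∧ IsOpen V ∧ q '' U ⊆ V ∧ Set.InjOn ψ V ∧ (∀ z ∈ V, IsLocalDiffeomorphAt (𝓡 4) (𝓡 4) ∞ ψ z) ∧ ∀ y ∈ U, ψ (q y) = WithLp.toLp 2 (fun j : Fin 4 => if j = 2 then ((((φ y 2 : ℝ) : ℂ) + ((φ y 3 : ℝ) : ℂ) * Complex.I) ^ n).re else if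 j = 3 then ((((φ y 2 : ℝ) : ℂ) + ((φ y 3 : ℝ) : ℂ) * Complex.I) ^ n).im else φ y j))

/-- item stmt-SmoothPoincare4-8193 · support · rank 9 · open · by planner
sources: KervaireMilnorAnnals1963, HambletonHausmann2010
[support] no 2-torsion among homotopy 4-spheres: if Σ # Σ (same orientation twice) is diffeomorphic
to S⁴ then Σ ≅ S⁴. Corollary of InvolutionQuotient (the swap involution of Σ # Σ = double cover of Σ
branched along an unknotted 2-sphere is a smooth involution of S⁴ with quotient Σ; the deck swap
preserves orientation, so it is Σ # Σ not Σ # Σ̄ — refuter-triage sharpening (ii)) and,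
independently, of the smooth Schoenflies conjecture (Σ° ⊂ S⁴ would be a Schoenflies ball); the
cheapest statement on which the line is tested — an order-2 exotic sphere refutes
InvolutionQuotient. [difficulty: open-problem] -/
@[route_item "route-SmoothPoincare4-QuotientSpheres"]
def NoTwoTorsion : Prop :=
  ∀ (S P : Literature.Topology.FourManifolds.HomotopySphere 4), Literature.Topology.FourManifolds.IsOrientedConnectedSum S.orientation S.orientation P.orientation → Nonempty (P.carrier ≃ₘ⟮𝓡 4, 𝓡 4⟯ Metric.sphere (0 : EuclideanSpace ℝ (Fin 5)) 1) → Nonempty (S.carrier ≃ₘ⟮𝓡 4, 𝓡 4⟯ Metric.sphere (0 : EuclideanSpace ℝ (Fin 5)) 1)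

/-- item stmt-SmoothPoincare4-8194 · support · rank 9 · open · by planner
sources: KervaireMilnorAnnals1963, HambletonHausmann2010
[support] every homotopy 4-sphere has finite order in the connected-sum monoid: Σ ≅ S⁴, or #ᵐ⁺²Σ ≅
S⁴ for some m (a chain T₀ = Σ#Σ, Tᵢ₊₁ = Tᵢ#Σ ending at S⁴). The dimension-4 shape of Kervaire–Milnor
finiteness; SUFFICIENT for CyclicShadows (glue, layer 2: the ℤ/(m+2)-rotation of the summands of
#ᵐ⁺²Σ ≅ S⁴ is a semifree action on S⁴ with unknotted-in-Σ branch sphere and quotient Σ); implied by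
SPC4; with InvolutionQuotient ∧ CyclicQuotient it gives 'no torsion' outright. [difficulty:
open-problem] -/
@[route_item "route-SmoothPoincare4-QuotientSpheres"]
def FiniteOrder : Prop :=
  ∀ S : Literature.Topology.FourManifolds.HomotopySphere 4, Nonempty (S.carrier ≃ₘ⟮𝓡 4, 𝓡 4⟯ Metric.sphere (0 : EuclideanSpace ℝ (Fin 5)) 1) ∨ ∃ (m : ℕ) (T : ℕ → Literature.Topology.FourManifolds.HomotopySphere 4), Literature.Topology.FourManifolds.IsOrientedConnectedSum S.orientation S.orientation (T 0).orientation ∧ (∀ i < m, Literature.Topology.FourManifolds.IsOrientedConnectedSum (T i).orientation S.orientation (T (i + 1)).orientation) ∧ Nonempty ((T m).carrier ≃ₘ⟮𝓡 4, 𝓡 4⟯ Metric.sphere (0 : EuclideanSpace ℝ (Fin 5)) 1)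

/-- item stmt-SmoothPoincare4-8195 · assembly · rank 1 · open · by planner
sources: HambletonHausmann2010, KervaireMilnorAnnals1963
[assembly] InvolutionQuotient → CyclicQuotient → CyclicShadows → SmoothPoincare4. -/
@[route_item "route-SmoothPoincare4-QuotientSpheres"]
def Assembly : Prop :=
  InvolutionQuotient → CyclicQuotient → CyclicShadows → SmoothPoincare4

/-! D-0027 §2.1 — DECIDING THEOREM (planner-authored via `route open/edit --closes-file`; by planner-rbadge-SmoothPoincare4-QuotientSpheres-99d09412-g4-0 2026-08-15T16:53:16Z):
its hypotheses are this route's items and its conclusion the sub-problem Statement (glue_lint), and it elaborates with this file. -/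

@[closes "route-SmoothPoincare4-QuotientSpheres"] theorem closes (hI : InvolutionQuotient) (hC : CyclicQuotient) (hS : CyclicShadows) :
    _root_.SmoothPoincare4 := by
  -- D-0027 §2.1 deciding theorem of route QuotientSpheres: pure logic over the two PROVED packaging
  -- facts (a smooth 4-manifold homotopy equivalent to S⁴ is compact — Hatcher Prop. 3.29 — and
  -- orientable — Lee Thm. 15.43): package `M ≃ₕ S⁴` as a `HomotopySphere 4`, let `CyclicShadows`
  -- exhibit it as an order-n cyclic branched quotient of the standard S⁴ (n ≥ 2), and conclude by
  -- `InvolutionQuotient` (n = 2) or `CyclicQuotient` (n ≥ 3).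
  unfold _root_.SmoothPoincare4 Literature.SPC4.SmoothPoincareConjectureFour
    ContinuousMap.HomotopyEquiv.NonemptyDiffeomorphSphere
  intro M _ _ _ _ _ e
  haveI : CompactSpace M :=
    Literature.Topology.FourManifolds.compactSpace_of_homotopyEquiv_sphere_four_holds M e
  obtain ⟨o⟩ :=
    Literature.Topology.FourManifolds.isOrientable_of_homotopyEquiv_sphere_four_holds M e
  obtain ⟨n, g, q, hn, hfix, hdata⟩ := hS ⟨M, o, ⟨e⟩⟩
  rcases Nat.lt_or_ge n 3 with hlt | hge
  · obtain rfl : n = 2 := by omega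
    exact hI g M q hfix hdata
  · exact hC n hge g M q hfix hdata

end Summit.SmoothPoincare4.SmoothPoincare4.Theses.QuotientSpheres
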